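import Summits.CriticalPhenomena.PercolationContinuityZ3.Theorems.PercNearOneGluingNoHeavyQuantLongTailTripleWideRoute
import Summits.CriticalPhenomena.PercolationContinuityZ3.Theorems.PercNearOneGluingNoHeavyQuantLongTailTripleWideRouteTwo
import Summits.CriticalPhenomena.PercolationContinuityZ3.Theorems.PercNearOneGluingNoHeavyQuantLongTailTripleHub
import HarnessLib

/-!
# QUANT lane R8, T-DEC: THE WIDE LONG-TAIL TRIPLE HUB — the width-3 sub-floor hub `S(γ₁) ∗ S(γ₂) ∗ S(γ₃)` of EVERY shape `{lo, lo+K; γ}` with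
# `3lo ≤ K ≤ 7lo/2` is SDEC at EVERY gate `γᵢ ≥ lo/K` and every affordable floor; hence the width-3 hub of every shape `lo < K ≤ 7lo/2` (census-1 gen 33)

builds on p205010 (kernel theorem, internal audit signed; external expert review pending)

Support file (`--supports stmt-CriticalPhenomena-4575`), QUANT lane seat prim-quant-census-1 (gen 33); memo
`run/shared/lean/prim/quant/prim-quant-census-1/g33/WIDE3-G33.md`.  Theorems only, standard axioms, no sorries.  Uses arm-1 g50's torque-cost criterion
`decAt_all_of_torqueCost` / g49's `decAt_all_of_lowCeiling`, g31's `lconv_sp_apply` / `sHub_laws` / `sHub_struct`, and this generation's routes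
`tripleWide_routeOne` (one low: `3lo+K` | `3lo+2K` | top) and `tripleWide_routeTwo` (two lows: both to the top).

THE LAW.  `sHub lo K [γ₁, γ₂, γ₃]` lives on `{3lo, 3lo+K, 3lo+2K, 3lo+3K}` with the Poisson-binomial masses `u₀..u₃` of the three gates, mean
`T₀ = 3lo + K(γ₁+γ₂+γ₃)`.  Gen 32 settled `K ≤ 2lo` (`sdec_sHub_three`, near route) and `2lo < K ≤ 3lo` (`sdec_sHub_three_long`, two cost branches, top
never used).  Beyond `3lo` three things change (memo §1): the atom `3lo+K` may be far; the second atom's credit capacity can fail (so the top IS needed, in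
a thin layer below `T = 6lo+2K`); and for near-one gates the gated mean exceeds `6lo+2K`, where `3lo+K` becomes a SECOND positive low — a two-row flow.
* **`sdec_sHub_three_wide`** — `3lo ≤ K`, `2K ≤ 7lo`; `P = [γ₁, γ₂, γ₃]` with `lo ≤ Kγᵢ`, `γᵢ < 1`, `x(lo+K) ≤ lo+Kγᵢ`; `0 < x` ⟹
  **`SDEC x ((lo+K)·3) (sHub lo K P)`**; **`sdec_sHub_three_upTo7half`** — with gen 32's `sdec_sHub_three_all` (`K ≤ 3lo`): every `lo < K ≤ 7lo/2`.
NUMERICS (memo §1, `g33/code/exp1_threebranch.py`, exact rationals, 12 shapes `3 ≤ K/lo ≤ 7/2`): every (hub, floor, gate) instance is certified by the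
rule (0 failures); the range `2K ≤ 7lo` is that of gen 32's top-route certificates `ltTop_*` (the rule itself has 0 failures up to `K = 4lo` on gen 32's
grids; `K ≤ 4.5lo` needs split routes at width 2 already).

HONEST STATUS.  A core lemma (width 3); with `sdec_sHub_two_all` (`K ≤ 4lo`) the hubs of widths 2 and 3 of every shape `lo < K ≤ 7lo/2` are SDEC at
every gate; the piece beside a blob for `K > 2lo` (split routes) and the widths `≥ 4` with gates below `1/2` remain the blockers of long-tail forest
theorems; `SiblingStep`, `GluedDominatedMass`, `SDECConvClosed`, `FarTreeRow` OPEN; RATE class (log\*) / honest sentence of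
`run/shared/lean/prim/quant/README.md` unchanged.  [this work].  Nothing here is cited as a published result.  The gluing rows served
[cite: KozmaNitzan2024, Conjecture 3 (p. 15)]; product measure [cite: Grimmett1999, §1.3 p. 10].
-/

noncomputable section
open scoped BigOperators

namespace Summit.CriticalPhenomena.PercolationContinuityZ3.Theorems
namespace Quant
namespace LawDec

/-- the FAR-GIANT PIECE of shape `(lo, K)`: `S(γ) = {lo: 1−γ, lo+K: γ}` -/
local notation3 "SP[" lo ", " K ", " a "]" => (fun h : ℕ => (1 - (a : ℝ)) * (if h = (lo : ℕ) then (1 : ℝ) else 0) +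
  (a : ℝ) * (if h = (lo : ℕ) + (K : ℕ) then (1 : ℝ) else 0))

/-! ### The wide long-tail triple hub is SDEC -/

set_option maxHeartbeats 800000 in
/-- **THE WIDE LONG-TAIL TRIPLE HUB IS SDEC.**  For `3lo ≤ K ≤ 7lo/2`, three gates `P = [γ₁, γ₂, γ₃]` with `lo ≤ Kγᵢ`, `γᵢ < 1`,
`x(lo+K) ≤ lo + Kγᵢ`, and every floor `0 < x`: `SDEC x ((lo+K)·|P|) (sHub lo K P)`. [this work] -/
theorem sdec_sHub_three_wide (lo K : ℕ) (hloK : lo < K) (hK3 : 3 * lo ≤ K) (hK7 : 2 * K ≤ 7 * lo) {x : ℝ} (hx0 : 0 < x) (P : List ℝ)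
    (hP3 : P.length = 3) (hP : ∀ γ ∈ P, (lo : ℝ) ≤ K * γ ∧ γ < 1 ∧ x * ((lo : ℝ) + K) ≤ lo + K * γ) :
    SDEC x ((lo + K) * P.length) (sHub lo K P) := by
  obtain ⟨γ₁, γ₂, γ₃, rfl⟩ := List.length_eq_three.1 hP3
  obtain ⟨hγ₁, hγ₁1, hx₁⟩ := hP γ₁ (by simp)
  obtain ⟨hγ₂, hγ₂1, hx₂⟩ := hP γ₂ (by simp)
  obtain ⟨hγ₃, hγ₃1, hx₃⟩ := hP γ₃ (by simp)
  have hlo1 : 1 ≤ lo := by omega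
  have hloR : (1 : ℝ) ≤ lo := by exact_mod_cast hlo1
  have hKR : (lo : ℝ) < K := by exact_mod_cast hloK
  have hK3R : 3 * (lo : ℝ) ≤ K := by exact_mod_cast hK3
  have hK0 : (0 : ℝ) < K := by linarith
  have hγ₁0 : 0 ≤ γ₁ := by
    by_contra hc; push Not at hc; have := mul_neg_of_pos_of_neg hK0 hc; linarith
  have hγ₂0 : 0 ≤ γ₂ := by
    by_contra hc; push Not at hc; have := mul_neg_of_pos_of_neg hK0 hc; linarith
  have hγ₃0 : 0 ≤ γ₃ := by
    by_contra hc; push Not at hc; have := mul_neg_of_pos_of_neg hK0 hc; linarith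
  have hx1 : x < 1 := by
    have : (lo : ℝ) + K * γ₁ < lo + K := by have := mul_lt_mul_of_pos_left hγ₁1 hK0; linarith
    by_contra hc; push Not at hc
    have : 1 * ((lo : ℝ) + K) ≤ x * (lo + K) := mul_le_mul_of_nonneg_right hc (by linarith)
    linarith
  -- the inner pair hub `L₂ = sHub lo K [γ₂, γ₃]`
  have hP01₂ : ∀ γ ∈ [γ₂, γ₃], 0 ≤ γ ∧ γ ≤ 1 := by
    intro γ hγ; simp only [List.mem_cons, List.mem_nil_iff, or_false] at hγ
    rcases hγ with rfl | rfl
    · exact ⟨hγ₂0, hγ₂1.le⟩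
    · exact ⟨hγ₃0, hγ₃1.le⟩
  obtain ⟨m0, mM, _, _⟩ := sHub_laws lo K [γ₂, γ₃] hP01₂
  have elen₂ : (lo + K) * ([γ₂, γ₃] : List ℝ).length = (lo + K) * 2 := rfl
  set L₂ : ℕ → ℝ := sHub lo K [γ₂, γ₃] with hL₂
  have cM : ∀ i, (lo + K) * 1 < i → SP[lo, K, γ₃] i = 0 := fun i hi => (sp_laws lo K hγ₃0 hγ₃1.le).2.1 i (by omega)
  have hS3 : sHub lo K [γ₃] = SP[lo, K, γ₃] := funext fun k => lconv_delta_left _ (lo + K) _ (sp_laws lo K hγ₃0 hγ₃1.le).2.1 k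
  have hdef₂ : L₂ = lconv ((lo + K) * 1) (lo + K) SP[lo, K, γ₃] SP[lo, K, γ₂] := by
    rw [hL₂]; show lconv _ _ (sHub lo K [γ₃]) _ = _; rw [hS3]; rfl
  have Lv₂ : ∀ k, L₂ k = (1 - γ₂) * (if lo ≤ k then SP[lo, K, γ₃] (k - lo) else 0) + γ₂ * (if lo + K ≤ k then SP[lo, K, γ₃] (k - (lo + K)) else 0) :=
    fun k => by rw [hdef₂]; exact lconv_sp_apply lo K ((lo + K) * 1) SP[lo, K, γ₃] γ₂ cM k
  have wlo : L₂ (2 * lo) = (1 - γ₂) * (1 - γ₃) := by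
    rw [Lv₂, if_pos (by omega), if_neg (by omega), show 2 * lo - lo = lo by omega]
    dsimp only; rw [if_pos rfl, if_neg (by omega)]; ring
  have wmid : L₂ (2 * lo + K) = γ₂ * (1 - γ₃) + γ₃ * (1 - γ₂) := by
    rw [Lv₂, if_pos (by omega), if_pos (by omega), show 2 * lo + K - lo = lo + K by omega, show 2 * lo + K - (lo + K) = lo by omega]
    dsimp only; rw [if_neg (by omega), if_pos rfl, if_pos rfl, if_neg (by omega)]; ring
  have wtop : L₂ (2 * lo + 2 * K) = γ₂ * γ₃ := by
    rw [Lv₂, if_pos (by omega), if_pos (by omega), show 2 * lo + 2 * K - lo = lo + 2 * K by omega,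
      show 2 * lo + 2 * K - (lo + K) = lo + K by omega]
    dsimp only; rw [if_neg (by omega), if_neg (by omega), if_neg (by omega), if_pos rfl]; ring
  have mM₂ : ∀ i, (lo + K) * 2 < i → L₂ i = 0 := fun i hi => mM i (by rw [elen₂]; exact hi)
  -- the triple hub `L = L₂ ∗ S(γ₁)`
  have hP01 : ∀ γ ∈ [γ₁, γ₂, γ₃], 0 ≤ γ ∧ γ ≤ 1 := by
    intro γ hγ; simp only [List.mem_cons, List.mem_nil_iff, or_false] at hγ
    rcases hγ with rfl | rfl | rfl
    · exact ⟨hγ₁0, hγ₁1.le⟩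
    · exact ⟨hγ₂0, hγ₂1.le⟩
    · exact ⟨hγ₃0, hγ₃1.le⟩
  obtain ⟨l0, lM, l1, lmean⟩ := sHub_laws lo K [γ₁, γ₂, γ₃] hP01
  have eT0 : (([γ₁, γ₂, γ₃] : List ℝ).map (fun γ => (lo : ℝ) + K * γ)).sum = 3 * (lo : ℝ) + K * (γ₁ + γ₂ + γ₃) := by
    simp only [List.map_cons, List.map_nil, List.sum_cons, List.sum_nil]; ring
  rw [eT0] at lmean
  have elen : (lo + K) * ([γ₁, γ₂, γ₃] : List ℝ).length = 3 * lo + 3 * K := by show (lo + K) * 3 = 3 * lo + 3 * K; ring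
  rw [elen] at lM l1 lmean ⊢
  set L : ℕ → ℝ := sHub lo K [γ₁, γ₂, γ₃] with hL
  have hdef : L = lconv ((lo + K) * 2) (lo + K) L₂ SP[lo, K, γ₁] := by rw [hL, hL₂]; rfl
  have Lv : ∀ k, L k = (1 - γ₁) * (if lo ≤ k then L₂ (k - lo) else 0) + γ₁ * (if lo + K ≤ k then L₂ (k - (lo + K)) else 0) :=
    fun k => by rw [hdef]; exact lconv_sp_apply lo K ((lo + K) * 2) L₂ γ₁ mM₂ k
  have vlo : L (3 * lo) = (1 - γ₁) * ((1 - γ₂) * (1 - γ₃)) := by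
    rw [Lv, if_pos (by omega), if_neg (by omega), show 3 * lo - lo = 2 * lo by omega, wlo]; ring
  have vmid : L (3 * lo + K) = (1 - γ₁) * (γ₂ * (1 - γ₃) + γ₃ * (1 - γ₂)) + γ₁ * ((1 - γ₂) * (1 - γ₃)) := by
    rw [Lv, if_pos (by omega), if_pos (by omega), show 3 * lo + K - lo = 2 * lo + K by omega, show 3 * lo + K - (lo + K) = 2 * lo by omega,
      wmid, wlo]
  have vtop : L (3 * lo + 2 * K) = (1 - γ₁) * (γ₂ * γ₃) + γ₁ * (γ₂ * (1 - γ₃) + γ₃ * (1 - γ₂)) := by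
    rw [Lv, if_pos (by omega), if_pos (by omega), show 3 * lo + 2 * K - lo = 2 * lo + 2 * K by omega,
      show 3 * lo + 2 * K - (lo + K) = 2 * lo + K by omega, wtop, wmid]
  have vmax : L (3 * lo + 3 * K) = γ₁ * (γ₂ * γ₃) := by
    rw [Lv, if_pos (by omega), if_pos (by omega), show 3 * lo + 3 * K - (lo + K) = 2 * lo + 2 * K by omega, wtop,
      mM₂ (3 * lo + 3 * K - lo) (by omega)]; ring
  -- support: charged atoms are `3lo + Ks`
  have hsupp : ∀ k, L k ≠ 0 → ∃ s, k = lo * 3 + K * s ∧ s ≤ 3 := by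
    intro k hk
    have := (sHub_struct lo K hloK 0 le_rfl [γ₁, γ₂, γ₃] (fun γ hγ => ⟨(hP01 γ hγ).1, (hP01 γ hγ).2, by
      rw [zero_mul]; exact (hP01 γ hγ).1⟩)).1 k hk
    simpa using this
  clear_value L₂ L
  intro a ha0 ha1 j' hj'
  obtain ⟨g0, gM, g1⟩ := gate_laws (3 * lo + 3 * K) L a ha0.le ha1 l0 lM l1
  have gmean : ∑ h ∈ Finset.range (3 * lo + 3 * K + 1), (h : ℝ) * gate L a h = a * (3 * (lo : ℝ) + K * (γ₁ + γ₂ + γ₃)) := by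
    rw [sum_mul_gate, lmean]
  have gv : ∀ h, h ≠ 0 → gate L a h = a * L h := fun h hh => by rw [gate_apply, if_neg hh, mul_zero, add_zero]
  set T : ℝ := a * (3 * (lo : ℝ) + K * (γ₁ + γ₂ + γ₃)) with hT
  have hax0 : 0 < a * x := mul_pos ha0 hx0
  have hax1 : a * x < 1 := by have := mul_le_mul_of_nonneg_right ha1 hx0.le; linarith
  have hT0p : 0 < 3 * (lo : ℝ) + K * (γ₁ + γ₂ + γ₃) := by
    have := mul_nonneg hK0.le (add_nonneg (add_nonneg hγ₁0 hγ₂0) hγ₃0); linarith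
  have hT0 : 0 < T := mul_pos ha0 hT0p
  have hTle : T ≤ 3 * (lo : ℝ) + K * (γ₁ + γ₂ + γ₃) := by
    have := mul_le_mul_of_nonneg_right ha1 hT0p.le; rw [hT]; linarith
  have hTtop : T < 3 * (lo : ℝ) + 3 * K := by
    have : (K : ℝ) * (γ₁ + γ₂ + γ₃) < K * 3 := mul_lt_mul_of_pos_left (by linarith) hK0
    linarith
  have hta : a * x * ((3 * lo + 3 * K : ℕ) : ℝ) ≤ T := by
    have h2 : x * (3 * (lo : ℝ) + 3 * K) ≤ 3 * (lo : ℝ) + K * (γ₁ + γ₂ + γ₃) := by linarith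
    have h3 := mul_le_mul_of_nonneg_left h2 ha0.le
    push_cast; rw [hT]; linarith
  have v0 : gate L a (3 * lo) = a * ((1 - γ₁) * ((1 - γ₂) * (1 - γ₃))) := by rw [gv _ (by omega), vlo]
  have v1 : gate L a (3 * lo + K) = a * ((1 - γ₁) * (γ₂ * (1 - γ₃) + γ₃ * (1 - γ₂)) + γ₁ * ((1 - γ₂) * (1 - γ₃))) := by
    rw [gv _ (by omega), vmid]
  have v2 : gate L a (3 * lo + 2 * K) = a * ((1 - γ₁) * (γ₂ * γ₃) + γ₁ * (γ₂ * (1 - γ₃) + γ₃ * (1 - γ₂))) := by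
    rw [gv _ (by omega), vtop]
  have v3 : gate L a (3 * lo + 3 * K) = a * (γ₁ * (γ₂ * γ₃)) := by rw [gv _ (by omega), vmax]
  -- a charged low is `3lo` or `3lo + K`
  have lowatom : ∀ l : ℕ, 1 ≤ l → 2 * (l : ℝ) < T → 0 < gate L a l → l = 3 * lo ∨ l = 3 * lo + K := by
    intro l hl hlT hpos
    have hLl : L l ≠ 0 := by
      intro h0; rw [gv l (by omega), h0, mul_zero] at hpos; exact lt_irrefl _ hpos
    obtain ⟨s, hs, _⟩ := hsupp l hLl
    rcases Nat.lt_or_ge s 2 with h2 | h2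
    · interval_cases s
      · left; rw [hs]; ring
      · right; rw [hs]; ring
    · exfalso
      have h1 : (K : ℝ) * 2 ≤ K * s := mul_le_mul_of_nonneg_left (by exact_mod_cast h2) hK0.le
      have hl' : (l : ℝ) = lo * 3 + K * s := by rw [hs]; push_cast; ring
      linarith
  -- the least gate: a 3-way symmetry reduction for the route lemmas
  have hmin : ∃ p q r : ℝ, ((p = γ₁ ∧ q = γ₂ ∧ r = γ₃) ∨ (p = γ₂ ∧ q = γ₁ ∧ r = γ₃) ∨ (p = γ₃ ∧ q = γ₁ ∧ r = γ₂)) ∧ p ≤ q ∧ p ≤ r := by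
    by_cases h12 : γ₁ ≤ γ₂
    · by_cases h13 : γ₁ ≤ γ₃
      · exact ⟨γ₁, γ₂, γ₃, Or.inl ⟨rfl, rfl, rfl⟩, h12, h13⟩
      · push Not at h13; exact ⟨γ₃, γ₁, γ₂, Or.inr (Or.inr ⟨rfl, rfl, rfl⟩), h13.le, le_trans h13.le h12⟩
    · push Not at h12
      by_cases h23 : γ₂ ≤ γ₃
      · exact ⟨γ₂, γ₁, γ₃, Or.inr (Or.inl ⟨rfl, rfl, rfl⟩), h12.le, h23⟩
      · push Not at h23; exact ⟨γ₃, γ₁, γ₂, Or.inr (Or.inr ⟨rfl, rfl, rfl⟩), le_trans h23.le h12.le, h23.le⟩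
  obtain ⟨p, q, r, hpqr, hpq, hpr⟩ := hmin
  have hpK : (lo : ℝ) ≤ K * p ∧ q < 1 ∧ r < 1 ∧ x * ((lo : ℝ) + K) ≤ lo + K * p := by
    rcases hpqr with ⟨rfl, rfl, rfl⟩ | ⟨rfl, rfl, rfl⟩ | ⟨rfl, rfl, rfl⟩
    · exact ⟨hγ₁, hγ₂1, hγ₃1, hx₁⟩
    · exact ⟨hγ₂, hγ₁1, hγ₃1, hx₂⟩
    · exact ⟨hγ₃, hγ₁1, hγ₂1, hx₃⟩
  obtain ⟨hp, hq1, hr1, hxp⟩ := hpK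
  have hTp : T = a * (3 * (lo : ℝ) + K * (p + q + r)) := by
    rcases hpqr with ⟨rfl, rfl, rfl⟩ | ⟨rfl, rfl, rfl⟩ | ⟨rfl, rfl, rfl⟩ <;> rw [hT] <;> ring
  have w0 : gate L a (3 * lo) = a * ((1 - p) * (1 - q) * (1 - r)) := by
    rcases hpqr with ⟨rfl, rfl, rfl⟩ | ⟨rfl, rfl, rfl⟩ | ⟨rfl, rfl, rfl⟩ <;> rw [v0] <;> ring
  have w1 : gate L a (3 * lo + K) = a * (p * (1 - q) * (1 - r) + q * (1 - p) * (1 - r) + r * (1 - p) * (1 - q)) := by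
    rcases hpqr with ⟨rfl, rfl, rfl⟩ | ⟨rfl, rfl, rfl⟩ | ⟨rfl, rfl, rfl⟩ <;> rw [v1] <;> ring
  have w2 : gate L a (3 * lo + 2 * K) = a * (p * q * (1 - r) + p * r * (1 - q) + q * r * (1 - p)) := by
    rcases hpqr with ⟨rfl, rfl, rfl⟩ | ⟨rfl, rfl, rfl⟩ | ⟨rfl, rfl, rfl⟩ <;> rw [v2] <;> ring
  have w3 : gate L a (3 * lo + 3 * K) = a * (p * q * r) := by
    rcases hpqr with ⟨rfl, rfl, rfl⟩ | ⟨rfl, rfl, rfl⟩ | ⟨rfl, rfl, rfl⟩ <;> rw [v3] <;> ring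
  clear hpqr
  have c3lo : ((3 * lo : ℕ) : ℝ) = 3 * (lo : ℝ) := by push_cast; ring
  by_cases hT6 : 6 * (lo : ℝ) < T
  · by_cases hT62 : T ≤ 6 * (lo : ℝ) + 2 * K
    · -- ONE positive low `3lo`: the three-branch route
      obtain ⟨t, ht, hTt, hcapt, hcostt⟩ := tripleWide_routeOne lo K hloK hK3 hK7 (gate L a) (a * x) T a p q r x g0 hpq hpr hp hq1 hr1 hx0
        hxp ha0 ha1 rfl hTp hT6 hT62 w0 w1 w2 w3
      have httop : t ≤ 3 * lo + 3 * K := by rcases ht with rfl | rfl | rfl <;> omega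
      have htmem : t ∈ Finset.range (3 * lo + 3 * K + 1) := Finset.mem_range.2 (by omega)
      have htlo : 3 * lo < t := by rcases ht with rfl | rfl | rfl <;> omega
      have colt : ∀ h : ℕ, ∑ l ∈ Finset.range (3 * lo + 3 * K + 1), freeRate (a * x) T l h * (if l = 3 * lo ∧ h = t then gate L a (3 * lo) else 0)
          = if h = t then freeRate (a * x) T (3 * lo) t * gate L a (3 * lo) else 0 := by
        intro h
        rw [Finset.sum_eq_single_of_mem (3 * lo) (Finset.mem_range.2 (by omega)) (fun l _ hl => by simp [hl])]
        by_cases hh : h = t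
        · subst hh; simp
        · simp [hh]
      refine decAt_all_of_torqueCost (a * x) (3 * lo + 3 * K) (gate L a) T
        (fun l h => if l = 3 * lo ∧ h = t then gate L a (3 * lo) else 0) hax0 hax1 g0 gM g1 gmean hT0 hta ?_ ?_ ?_ ?_ ?_ j' hj'
      · intro l h; split_ifs
        · exact g0 _
        · exact le_rfl
      · intro l h hlh
        split_ifs at hlh with hc
        · obtain ⟨rfl, rfl⟩ := hc
          exact ⟨by omega, by rw [c3lo]; linarith, htlo, httop, hTt⟩
        · exact absurd hlh (lt_irrefl _)
      · intro l hl hlow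
        by_cases hl' : l = 3 * lo
        · subst hl'
          rw [Finset.sum_eq_single_of_mem t htmem (fun h _ hh => by simp [hh])]; simp
        · rw [Finset.sum_eq_zero fun h _ => by simp [hl']]
          rcases (g0 l).eq_or_lt with h0 | hpos
          · exact h0
          · exfalso
            rcases lowatom l hl hlow hpos with h | h
            · exact hl' h
            · subst h; push_cast at hlow; linarith
      · intro h _
        rw [colt h]
        split_ifs with hh
        · subst hh; exact hcapt
        · exact g0 h
      · rw [Finset.sum_eq_single_of_mem t htmem (fun h _ hh => by rw [colt h, if_neg hh, mul_zero, ite_self])]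
        rw [colt t, if_pos rfl]
        exact hcostt
    · -- TWO positive lows `3lo`, `3lo+K`: both to the top
      push Not at hT62
      obtain ⟨hcap2, hcost2⟩ := tripleWide_routeTwo lo K hloK hK3 hK7 (gate L a) (a * x) T a p q r x g0 hpq hpr hp hq1 hr1 hx0 hxp ha0 ha1
        rfl hTp hT62 w0 w1 w2 w3
      have hne : 3 * lo ≠ 3 * lo + K := by omega
      set M : ℕ := 3 * lo + 3 * K with hM
      have cMR : ((M : ℕ) : ℝ) = 3 * (lo : ℝ) + 3 * K := by rw [hM]; push_cast; ring
      set f : ℕ → ℕ → ℝ := fun l h => if h = M ∧ (l = 3 * lo ∨ l = 3 * lo + K) then gate L a l else 0 with hf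
      have fM : ∀ l, f l M = if (l = 3 * lo ∨ l = 3 * lo + K) then gate L a l else 0 := by
        intro l; rw [hf]; dsimp only; by_cases hl : l = 3 * lo ∨ l = 3 * lo + K
        · rw [if_pos ⟨rfl, hl⟩, if_pos hl]
        · rw [if_neg (fun hc => hl hc.2), if_neg hl]
      have fne : ∀ l h, h ≠ M → f l h = 0 := by intro l h hh; rw [hf]; dsimp only; rw [if_neg (fun hc => hh hc.1)]
      have colM : ∑ l ∈ Finset.range (M + 1), freeRate (a * x) T l M * f l M
          = freeRate (a * x) T (3 * lo) M * gate L a (3 * lo) + freeRate (a * x) T (3 * lo + K) M * gate L a (3 * lo + K) := by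
        rw [Finset.sum_eq_add_of_mem (3 * lo) (3 * lo + K) (Finset.mem_range.2 (by omega)) (Finset.mem_range.2 (by omega)) hne
          (fun l _ hl => by rw [fM, if_neg (not_or.2 hl), mul_zero])]
        rw [fM, fM, if_pos (Or.inl rfl), if_pos (Or.inr rfl)]
      refine decAt_all_of_torqueCost (a * x) M (gate L a) T f hax0 hax1 g0 gM g1 gmean hT0 hta ?_ ?_ ?_ ?_ ?_ j' hj'
      · intro l h; rw [hf]; dsimp only; split_ifs
        · exact g0 _
        · exact le_rfl
      · intro l h hlh
        rw [hf] at hlh; dsimp only at hlh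
        split_ifs at hlh with hc
        · obtain ⟨rfl, hl⟩ := hc
          rcases hl with rfl | rfl
          · exact ⟨by omega, by push_cast; linarith, by omega, le_rfl, by rw [cMR]; push_cast; linarith⟩
          · exact ⟨by omega, by push_cast; linarith, by omega, le_rfl, by rw [cMR]; push_cast; linarith⟩
        · exact absurd hlh (lt_irrefl _)
      · intro l hl hlow
        rw [Finset.sum_eq_single_of_mem M (Finset.mem_range.2 (by omega)) (fun h _ hh => fne l h hh), fM]
        split_ifs with hl2
        · rfl
        · rcases (g0 l).eq_or_lt with h0 | hpos
          · exact h0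
          · exact absurd (lowatom l hl hlow hpos) hl2
      · intro h _
        by_cases hh : h = M
        · subst hh; rw [colM]; exact hcap2
        · rw [Finset.sum_eq_zero fun l _ => by rw [fne l h hh, mul_zero]]; exact g0 h
      · rw [Finset.sum_eq_single_of_mem M (Finset.mem_range.2 (by omega))
          (fun h _ hh => by rw [Finset.sum_eq_zero fun l _ => by rw [fne l h hh, mul_zero], mul_zero, ite_self])]
        rw [colM, if_pos (by rw [cMR]; linarith)]
        exact hcost2
  · -- no positive low atom
    refine decAt_all_of_lowCeiling (a * x) (3 * lo + 3 * K) (gate L a) T hax0 hax1 g0 gM g1 gmean hT0 hta ?_ j' hj'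
    intro l hl hlow hpos
    exfalso
    rcases lowatom l hl hlow hpos with h | h <;> subst h <;> push_cast at hlow <;> linarith

/-- **THE WIDTH-3 HUB OF EVERY SHAPE `lo < K ≤ 7lo/2` IS SDEC** at every gate `γᵢ ≥ lo/K` and every affordable floor (gen 32's `sdec_sHub_three_all`
for `K ≤ 3lo`, `sdec_sHub_three_wide` for `3lo ≤ K ≤ 7lo/2`). [this work] -/
theorem sdec_sHub_three_upTo7half (lo K : ℕ) (hloK : lo < K) (hK7 : 2 * K ≤ 7 * lo) {x : ℝ} (hx0 : 0 < x) (P : List ℝ) (hP3 : P.length = 3)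
    (hP : ∀ γ ∈ P, (lo : ℝ) ≤ K * γ ∧ γ < 1 ∧ x * ((lo : ℝ) + K) ≤ lo + K * γ) :
    SDEC x ((lo + K) * P.length) (sHub lo K P) := by
  rcases le_or_gt K (3 * lo) with h | h
  · exact sdec_sHub_three_all lo K hloK h hx0 P hP3 hP
  · exact sdec_sHub_three_wide lo K hloK h.le hK7 hx0 P hP3 hP

end LawDec
end Quant
end Summit.CriticalPhenomena.PercolationContinuityZ3.Theorems
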